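import Summits.ValiantsHypothesis.ValiantsHypothesis.Theorems.RigidityForcesSymmetryRankRigidMinimalReprLaplaceResidualFibreSum

/-!
# Case 1 of the `a = 3` residual blueprint: STEP 0 (a full-support covector orthogonal to a non-indicator slice vector)
# and the KERNEL LINE of the `2 × 2` permanents (crux `RankRigidMinimalRepr`, stmt-18034; frontier rung `LaplaceOptimalFive`, stmt-24813)

FILE 2b of the `a = 3` residual blueprint (val-lit-p8 g11, `NOTE-p8g11-24813-a3-class-residual4.md` §v3, «STEP 0» and
the REDUCTION «it suffices to exhibit ONE φ₁ ∈ V₁ with dim Ann₁(ℓ₀ℓ₁) ≤ 1»; val-lit desk RULING #258 (a); seat val-port-2).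
Elementary inputs of the Case-1 assembly, all over `Fin 5 → ℂ`, no definitions:
* `not_indicator_cases` — a slice vector that is NOT a non-zero multiple of a basis vector is either `0` or has two
  distinct non-zero coordinates;
* **`exists_fullSupport_orthogonal`** (STEP 0) — in that case there is a covector `φ₀` with ALL coordinates non-zero and
  `Σ_c φ₀(c) α(c) = 0` (the slice kill `hkS` of `LaplaceFiveSlices.refute_of_kills` for the slice `α`); explicit: `φ₀ ≡ 1`
  off two letters `a, b` of the support, `φ₀(b) = t ∈ {1, 2}` chosen so that `t α(b) + Σ_{c ≠ a,b} α(c) ≠ 0`, and `φ₀(a)`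
  solved for;
* **`pairPerm_solution_on_line`** (the kernel line) — if `φ₁(a) ≠ 0` and all `2 × 2` permanents
  `φ₁(x)φ₂(y) + φ₁(y)φ₂(x)` (`x ≠ y`) vanish, then `φ₂` lies on the explicit LINE through
  `w = e_a − Σ_{y ≠ a} (φ₁(y)/φ₁(a)) e_y`: `φ₂(y) = φ₂(a) · w(y)`; so the solution space has dimension `≤ 1`;
* `fibreSum_kernel_on_line` — composed with LEMMA Z in the two-slot currency (`pairPerm_eq_zero_of_fibreSum_eq_zero`,
  FILE 2a): for `φ₀` of full support and `φ₁(a) ≠ 0`, every `φ₂` killing the bilinear form of the two-slot expansion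
  (`F(x,y) = 0` for all `x ≠ y`) lies on that line — the «dim ker(φ₂ ↦ M) ≤ 1» input of the REDUCTION.
What is NOT here (located for the successor): the dimension count on `V₂` (rank–nullity: a linear map from a space of
dimension `≥ 3` into a line has kernel of dimension `≥ 2`), the instantiation of `refute_of_kills` for the two residual
types with `(φ₃, φ₄)` from `bilinear_proportional`, and CASE 2 (`α = κ e_a`).  HONEST FRAMING: elementary helper lemmas;
the hypothesis `hres` of `laplace_five_at_most_two_slices_of_residual` is NOT discharged here; 24813/24814/18034 stay
OPEN; nothing here bears on `VP ≠ VNP`. [folklore]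
-/

set_option autoImplicit false

-- the mandated summit-side namespace repeats a component by design (single-problem summit)
set_option linter.dupNamespace false

namespace Summit.ValiantsHypothesis.ValiantsHypothesis.Theorems.RigidityForcesSymmetryRankRigidMinimalRepr

namespace LaplaceResidual

open Finset

/-! ### §1 STEP 0: a full-support covector orthogonal to a non-indicator slice vector -/

/-- A vector on `Fin 5` that is not a non-zero multiple of a basis vector is `0` or has two distinct non-zero
coordinates. [folklore] -/
theorem not_indicator_cases (α : Fin 5 → ℂ) (h : ¬ ∃ a, α a ≠ 0 ∧ ∀ c, c ≠ a → α c = 0) :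
    α = 0 ∨ ∃ a b, a ≠ b ∧ α a ≠ 0 ∧ α b ≠ 0 := by
  by_cases hz : ∀ c, α c = 0
  · exact Or.inl (funext hz)
  · push Not at hz
    obtain ⟨a, ha⟩ := hz
    push Not at h
    obtain ⟨c, hca, hc⟩ := h a ha
    exact Or.inr ⟨a, c, fun e => hca e.symm, ha, hc⟩

/-- **STEP 0.**  If the slice vector `α` is `0` or has two distinct non-zero coordinates, some covector `φ₀` with ALL
coordinates non-zero satisfies the slice kill `Σ_c φ₀(c) α(c) = 0`. [folklore] -/
theorem exists_fullSupport_orthogonal (α : Fin 5 → ℂ) (h : α = 0 ∨ ∃ a b, a ≠ b ∧ α a ≠ 0 ∧ α b ≠ 0) :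
    ∃ φ₀ : Fin 5 → ℂ, (∀ c, φ₀ c ≠ 0) ∧ ∑ c, φ₀ c * α c = 0 := by
  classical
  rcases h with h0 | ⟨a, b, hab, ha, hb⟩
  · refine ⟨fun _ => 1, fun _ => one_ne_zero, ?_⟩
    simp [h0]
  · -- the rest of the slice vector
    set R : ℂ := ∑ c, if c = a ∨ c = b then 0 else α c with hR
    -- choose `t ∈ {1, 2}` with `t α(b) + R ≠ 0`
    obtain ⟨t, ht0, htD⟩ : ∃ t : ℂ, t ≠ 0 ∧ t * α b + R ≠ 0 := by
      by_cases h1 : α b + R = 0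
      · refine ⟨2, two_ne_zero, ?_⟩
        intro h2
        apply hb
        linear_combination h2 - h1
      · exact ⟨1, one_ne_zero, by rwa [one_mul]⟩
    set D : ℂ := t * α b + R with hD
    -- the covector: `1` off `{a, b}`, `t` at `b`, `-D/α(a)` at `a`
    let φ₀ : Fin 5 → ℂ := fun c => if c = a then -D / α a else if c = b then t else 1
    refine ⟨φ₀, fun c => ?_, ?_⟩
    · by_cases hca : c = a
      · rw [show φ₀ c = -D / α a by simp only [φ₀, if_pos hca]]
        exact div_ne_zero (neg_ne_zero.2 htD) ha
      · by_cases hcb : c = b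
        · rw [show φ₀ c = t by simp only [φ₀, if_neg hca, if_pos hcb]]
          exact ht0
        · rw [show φ₀ c = 1 by simp only [φ₀, if_neg hca, if_neg hcb]]
          exact one_ne_zero
    · -- pointwise: `φ₀ c α c = [c = a](−D) + [c = b] t α b + [c ∉ {a,b}] α c`
      have hpt : ∀ c, φ₀ c * α c =
          (if c = a then -D else 0) + ((if c = b then t * α b else 0) + (if c = a ∨ c = b then 0 else α c)) := by
        intro c
        by_cases hca : c = a
        · subst hca
          simp only [φ₀, if_true, if_neg hab, true_or]
          field_simp
          ring
        · by_cases hcb : c = b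
          · subst hcb
            simp only [φ₀, if_neg hca, if_true, or_true]
            ring
          · simp only [φ₀, if_neg hca, hca, hcb, or_self, if_false]
            ring
      rw [Finset.sum_congr rfl (fun c _ => hpt c), Finset.sum_add_distrib, Finset.sum_add_distrib,
        Finset.sum_ite_eq' univ a, Finset.sum_ite_eq' univ b, if_pos (mem_univ _), if_pos (mem_univ _), ← hR, hD]
      ring

/-- STEP 0 from the blueprint's Case-1 hypothesis «`α` is not a non-zero multiple of a basis vector». [folklore] -/
theorem exists_fullSupport_orthogonal' (α : Fin 5 → ℂ) (h : ¬ ∃ a, α a ≠ 0 ∧ ∀ c, c ≠ a → α c = 0) :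
    ∃ φ₀ : Fin 5 → ℂ, (∀ c, φ₀ c ≠ 0) ∧ ∑ c, φ₀ c * α c = 0 :=
  exists_fullSupport_orthogonal α (not_indicator_cases α h)

/-! ### §2 The kernel line of the `2 × 2` permanents -/

/-- **The kernel line.**  If `φ₁(a) ≠ 0` and all `2 × 2` permanents `φ₁(x)φ₂(y) + φ₁(y)φ₂(x)`, `x ≠ y`, vanish, then
`φ₂` lies on the explicit line through `w = e_a − Σ_{y ≠ a} (φ₁(y)/φ₁(a)) e_y`:
`φ₂(y) = φ₂(a) · (if y = a then 1 else −φ₁(y)/φ₁(a))`.  Hence the space of such `φ₂` has dimension `≤ 1`. [folklore] -/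
theorem pairPerm_solution_on_line (φ₁ φ₂ : Fin 5 → ℂ) (a : Fin 5) (ha : φ₁ a ≠ 0)
    (hP : ∀ x y : Fin 5, x ≠ y → φ₁ x * φ₂ y + φ₁ y * φ₂ x = 0) :
    ∀ y, φ₂ y = φ₂ a * (if y = a then 1 else -(φ₁ y / φ₁ a)) := by
  intro y
  by_cases hy : y = a
  · subst hy; simp
  · rw [if_neg hy]
    have h := hP a y (fun e => hy e.symm)
    field_simp
    linear_combination h

/-- Two solutions of the kernel system are proportional: with `φ₁(a) ≠ 0`, if both `φ₂` and `φ₂'` kill all `2 × 2`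
permanents against `φ₁`, then `φ₂'(a) • φ₂ = φ₂(a) • φ₂'`. [folklore] -/
theorem pairPerm_solutions_proportional (φ₁ φ₂ φ₂' : Fin 5 → ℂ) (a : Fin 5) (ha : φ₁ a ≠ 0)
    (hP : ∀ x y : Fin 5, x ≠ y → φ₁ x * φ₂ y + φ₁ y * φ₂ x = 0)
    (hP' : ∀ x y : Fin 5, x ≠ y → φ₁ x * φ₂' y + φ₁ y * φ₂' x = 0) :
    ∀ y, φ₂' a * φ₂ y = φ₂ a * φ₂' y := by
  intro y
  rw [pairPerm_solution_on_line φ₁ φ₂ a ha hP y, pairPerm_solution_on_line φ₁ φ₂' a ha hP' y]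
  ring

/-- **The kernel of the two-slot bilinear form lies on the line** (LEMMA Z in currency + the kernel line): for `φ₀` of
full support and `φ₁(a) ≠ 0`, every `φ₂` for which all fibre sums `F(x,y)`, `x ≠ y`, of `permanent_two_slot` vanish
satisfies `φ₂(y) = φ₂(a) · (if y = a then 1 else −φ₁(y)/φ₁(a))` — the «dim ker(φ₂ ↦ M) ≤ 1» input of the blueprint's
REDUCTION step. [folklore] -/
theorem fibreSum_kernel_on_line (φ : Fin 5 → Fin 5 → ℂ) (h0 : ∀ c, φ 0 c ≠ 0) (a : Fin 5) (ha : φ 1 a ≠ 0)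
    (hF : ∀ x y : Fin 5, x ≠ y →
      (∑ τ : Equiv.Perm (Fin 5), if τ 3 = x ∧ τ 4 = y then φ 0 (τ 0) * φ 1 (τ 1) * φ 2 (τ 2) else 0) = 0) :
    ∀ y, φ 2 y = φ 2 a * (if y = a then 1 else -(φ 1 y / φ 1 a)) :=
  pairPerm_solution_on_line (φ 1) (φ 2) a ha (fun x y hxy => pairPerm_eq_zero_of_fibreSum_eq_zero φ h0 hF x y hxy)

end LaplaceResidual

end Summit.ValiantsHypothesis.ValiantsHypothesis.Theorems.RigidityForcesSymmetryRankRigidMinimalRepr
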